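import Literature.AlgebraicGeometry.HodgeTheory.CotangentSheafComap
import Literature.AlgebraicGeometry.Modules.PullbackAffineChart
import Mathlib.CategoryTheory.Adjunction.FullyFaithful
import HarnessLib

/-!
# `dg` on `1`-forms in PULL-BACK form: `g^*Ω¹_{X₁/S} ⟶ Ω¹_{X₀/S}`

Layer `Literature/AlgebraicGeometry/HodgeTheory`; companion of `CotangentSheafComap.lean`, which constructs the
pull-back of `1`-forms along a morphism `g : X₀ ⟶ X₁` of `S`-schemes (`Over (Spec S)`, `S` any commutative ring)
in ADJOINT form `g^♯ = cotangentSheaf.comap g : Ω¹_{X₁/S} ⟶ g_* Ω¹_{X₀/S}` and lists «Not here: `g^*Ω¹_{X₁/S} →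
Ω¹_{X₀/S}` in pull-back form». This file supplies that form for Mathlib's abstract inverse image
`Scheme.Modules.pullback` (a left adjoint with no sections formula), exactly as
`HodgeTheory/HodgeSheafPullbackForms.lean` does for the Hodge sheaves `Ω^q` (`pullbackForms g q`):

* `cotangentSheaf.pullbackHom g : g^*Ω¹_{X₁/S} ⟶ Ω¹_{X₀/S}` — the transpose of `cotangentSheaf.comap g` under
  `Scheme.Modules.pullbackPushforwardAdjunction g.left` (Hartshorne II Prop. 8.11: the first map of
  `f^*Ω_{Y/Z} → Ω_{X/Z} → Ω_{X/Y} → 0`);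
* `cotangentSheaf.homEquiv_pullbackHom` — its transpose back is `comap g`;
* `cotangentSheaf.pullbackHom_app_unitSection` — **transpose identity** `dg(η(ω)) = g^♯ω` on the pulled-back sections
  `η(ω) ∈ Γ(g⁻¹V, g^*Ω¹_{X₁})` (`Modules/PullbackUnitSections.unitSection`) of a `1`-form `ω ∈ Γ(V, Ω¹_{X₁})`, and
  `cotangentSheaf.pullbackHom_app_unitSection_dSection` — `dg(η(da)) = d(g♯a)` (`comap_app_dSection`);
* `cotangentSheaf.homEquiv_app` — the transpose `φ♭ : Ω¹_{X₁} ⟶ g_*N` of ANY `φ : g^*Ω¹_{X₁} ⟶ N` is computed on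
  sections by `φ♭(ω) = φ(η(ω))`, whence the extensionality principle
  **`cotangentSheaf.pullback_hom_ext`**: two `𝒪_{X₀}`-linear maps out of `g^*Ω¹_{X₁/S}` that agree on the pulled-back
  exact forms `η(da)` (`a` a local function on `X₁`) are equal (transpose + `cotangentSheaf.hom_ext_dSection`). This is
  the tool by which identities between maps out of `g^*Ω¹` (chain rule, product formula, shear isomorphisms) are
  checked on generators.

Everything is proved; one `def`, no named fact, no instance, no notation. Motivation: the product formula
`pr₁^*Ω¹_X ⊕ pr₂^*Ω¹_Y ≅ Ω¹_{X ×_S Y}` and the Bosch–Lütkebohmert–Raynaud shear argument for the cotangent sheaf of a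
group scheme (`Ω¹_{G/k} ≅ π^* e^* Ω¹_{G/k}`, Néron Models §4.2 Prop. 2), which are phrased with maps OUT of pulled-back
cotangent sheaves (Hodge road №4, crux stmt-HodgeConjecture-26512, stub `stub_cotangentSheafFree`).

§2 (functoriality): the extensionality principles for maps out of `f^*M` (any `M`, test on `η(m)`) and out of
`g^*g'^*Ω¹_{X₂}` (test on `η_g(η_{g'}(da))`); the **chain rule** `cotangentSheaf.pullbackComp_hom_comp_pullbackHom`:
`d(g ≫ g') = (g^* dg') ≫ dg` up to Mathlib's pseudofunctoriality isomorphism `Scheme.Modules.pullbackComp`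
(Hartshorne II Prop. 8.11 is functorial; BLR §2.1 Prop. 3); `pullbackHom` along equal morphisms (`pullbackCongr`), along
the identity (`= Scheme.Modules.pullbackId`, via `pullbackId_hom_app_unitSection`: `(𝟙)^*` fixes pulled-back sections) and
along an isomorphism of `S`-schemes (`isIso_pullbackHom_of_iso`: `dg = g^*(g^♯) ≫ ε` with `g^♯` an isomorphism by
`CotangentSheafComap.isIso_comap_hom` and the counit `ε` of `g^* ⊣ g_*` an isomorphism because `g_*` is fully faithful).

Not here (sequel): the chart formula `c ⊗ da ↦ c • d(g♯a)` on affine charts (`Modules/PullbackAffineChart.chartSectionsEquiv`).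

## References

* R. Hartshorne, *Algebraic Geometry*, GTM 52 (1977), II Prop. 8.11 (`f^*Ω_{Y/Z} → Ω_{X/Z}`), II §5 p. 110
  (`f^*` left adjoint to `f_*`). [Hartshorne1977]
* S. Bosch, W. Lütkebohmert, M. Raynaud, *Néron Models*, Springer (1990), §2.1 Prop. 3 (functoriality and base change
  of differentials), §4.2 Prop. 2. [BoschLutkebohmertRaynaud1990]
-/

noncomputable section

-- `TopCat.Presheaf`/`Scheme.Modules` are not reducible (as in Mathlib's `AlgebraicGeometry/Modules/Sheaf.lean`).
set_option backward.isDefEq.respectTransparency false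

open CategoryTheory CategoryTheory.Limits AlgebraicGeometry Opposite TopologicalSpace

universe u

namespace Literature.AlgebraicGeometry.HodgeTheory

open Literature.AlgebraicGeometry.Modules Literature.AlgebraicGeometry.Motives

section PullbackHom

variable {S : Type u} [CommRing S] {X₀ X₁ : Over (Spec (CommRingCat.of S))} (g : X₀ ⟶ X₁)

/-- **`dg` on `1`-forms in pull-back form** for a morphism `g : X₀ ⟶ X₁` of `S`-schemes: the `𝒪_{X₀}`-linear map
`g^*Ω¹_{X₁/S} ⟶ Ω¹_{X₀/S}` adjoint (Mathlib `Scheme.Modules.pullbackPushforwardAdjunction`) to the pull-back of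
`1`-forms `g^♯ = cotangentSheaf.comap g : Ω¹_{X₁/S} ⟶ g_*Ω¹_{X₀/S}`.
[cite: Hartshorne1977, II Prop. 8.11 (the first map f^*Ω_{Y/Z} → Ω_{X/Z})] -/
def cotangentSheaf.pullbackHom :
    (Scheme.Modules.pullback g.left).obj (cotangentSheaf X₁) ⟶ cotangentSheaf X₀ :=
  ((Scheme.Modules.pullbackPushforwardAdjunction g.left).homEquiv _ _).symm (cotangentSheaf.comap g)

/-- The transpose of `cotangentSheaf.pullbackHom g` under `g^* ⊣ g_*` is `cotangentSheaf.comap g`.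
[cite: Hartshorne1977, II §5 p. 110 (f^* ⊣ f_*) and II Prop. 8.11] -/
theorem cotangentSheaf.homEquiv_pullbackHom :
    (Scheme.Modules.pullbackPushforwardAdjunction g.left).homEquiv _ _ (cotangentSheaf.pullbackHom g) =
      cotangentSheaf.comap g :=
  Equiv.apply_symm_apply _ _

variable {g} in
/-- **The transpose on sections**: for any `𝒪_{X₀}`-linear `φ : g^*Ω¹_{X₁/S} ⟶ N`, its transpose
`φ♭ : Ω¹_{X₁/S} ⟶ g_*N` sends `ω ∈ Γ(V, Ω¹_{X₁})` to `φ(η(ω)) ∈ Γ(g⁻¹V, N)`, `η(ω)` the pulled-back section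
(`φ♭ = η ≫ g_*φ`, Mathlib `Adjunction.homEquiv_unit`). [cite: Hartshorne1977, II §5 p. 110 (f^* ⊣ f_*)] -/
theorem cotangentSheaf.homEquiv_app {N : X₀.left.Modules}
    (φ : (Scheme.Modules.pullback g.left).obj (cotangentSheaf X₁) ⟶ N) (V : X₁.left.Opens)
    (ω : Γ(cotangentSheaf X₁, V)) :
    ((Scheme.Modules.pullbackPushforwardAdjunction g.left).homEquiv _ _ φ).app V ω =
      φ.app (g.left ⁻¹ᵁ V) (unitSection g.left (cotangentSheaf X₁) V ω) := by
  rw [Adjunction.homEquiv_unit]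
  rfl

/-- **Transpose identity**: `dg` applied to the pulled-back section `η(ω) ∈ Γ(g⁻¹V, g^*Ω¹_{X₁})` of a `1`-form
`ω ∈ Γ(V, Ω¹_{X₁})` is `g^♯ω ∈ Γ(g⁻¹V, Ω¹_{X₀})`.
[cite: Hartshorne1977, II §5 p. 110 (f^* ⊣ f_*) and II Prop. 8.11] -/
theorem cotangentSheaf.pullbackHom_app_unitSection (V : X₁.left.Opens) (ω : Γ(cotangentSheaf X₁, V)) :
    (cotangentSheaf.pullbackHom g).app (g.left ⁻¹ᵁ V) (unitSection g.left (cotangentSheaf X₁) V ω) =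
      (cotangentSheaf.comap g).app V ω := by
  rw [← cotangentSheaf.homEquiv_app, cotangentSheaf.homEquiv_pullbackHom]

/-- **`dg(η(da)) = d(g♯a)`**: on the pulled-back differential of a local function `a ∈ Γ(V, 𝒪_{X₁})`, `dg` is the
differential of the pulled-back function `g♯a ∈ Γ(g⁻¹V, 𝒪_{X₀})`.
[cite: Hartshorne1977, II Prop. 8.11 (the first map f^*Ω_{Y/Z} → Ω_{X/Z})] -/
theorem cotangentSheaf.pullbackHom_app_unitSection_dSection (V : X₁.left.Opens) (a : Γ(X₁.left, V)) :
    (cotangentSheaf.pullbackHom g).app (g.left ⁻¹ᵁ V)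
        (unitSection g.left (cotangentSheaf X₁) V (dSection X₁ V a)) =
      dSection X₀ (g.left ⁻¹ᵁ V) (g.left.app V a) := by
  rw [cotangentSheaf.pullbackHom_app_unitSection, comap_app_dSection]

variable {g} in
/-- **Two `𝒪_{X₀}`-linear maps out of `g^*Ω¹_{X₁/S}` that agree on all pulled-back `1`-forms `η(ω)` are equal**
(their transposes `Ω¹_{X₁} ⟶ g_*N` agree on sections, `cotangentSheaf.homEquiv_app`).
[cite: Hartshorne1977, II §5 p. 110 (f^* ⊣ f_*)] -/
theorem cotangentSheaf.pullback_hom_ext_unitSection {N : X₀.left.Modules}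
    (φ₁ φ₂ : (Scheme.Modules.pullback g.left).obj (cotangentSheaf X₁) ⟶ N)
    (h : ∀ (V : X₁.left.Opens) (ω : Γ(cotangentSheaf X₁, V)),
      φ₁.app (g.left ⁻¹ᵁ V) (unitSection g.left (cotangentSheaf X₁) V ω) =
        φ₂.app (g.left ⁻¹ᵁ V) (unitSection g.left (cotangentSheaf X₁) V ω)) : φ₁ = φ₂ := by
  apply ((Scheme.Modules.pullbackPushforwardAdjunction g.left).homEquiv _ _).injective
  refine Scheme.Modules.hom_ext _ _ fun V => ?_
  ext ω
  rw [cotangentSheaf.homEquiv_app, cotangentSheaf.homEquiv_app]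
  exact h V ω

variable {g} in
/-- **Two `𝒪_{X₀}`-linear maps out of `g^*Ω¹_{X₁/S}` that agree on the pulled-back exact forms `η(da)` (`a` a local
function on `X₁`) are equal** — transpose to `Ω¹_{X₁/S} ⟶ g_*N` and use that `Ω¹_{X₁/S}` is generated by the `da`
(`cotangentSheaf.hom_ext_dSection`). This is how identities between maps out of `g^*Ω¹` are checked on generators.
[cite: Hartshorne1977, II.8 (p. 172–175: Ω_{B/A} is generated by the db) and II §5 p. 110 (f^* ⊣ f_*)] -/
theorem cotangentSheaf.pullback_hom_ext {N : X₀.left.Modules}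
    (φ₁ φ₂ : (Scheme.Modules.pullback g.left).obj (cotangentSheaf X₁) ⟶ N)
    (h : ∀ (V : X₁.left.Opens) (a : Γ(X₁.left, V)),
      φ₁.app (g.left ⁻¹ᵁ V) (unitSection g.left (cotangentSheaf X₁) V (dSection X₁ V a)) =
        φ₂.app (g.left ⁻¹ᵁ V) (unitSection g.left (cotangentSheaf X₁) V (dSection X₁ V a))) : φ₁ = φ₂ := by
  apply ((Scheme.Modules.pullbackPushforwardAdjunction g.left).homEquiv _ _).injective
  refine cotangentSheaf.hom_ext_dSection _ _ fun V a => ?_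
  rw [cotangentSheaf.homEquiv_app, cotangentSheaf.homEquiv_app]
  exact h V a

/-- `dg` is the UNIQUE `𝒪_{X₀}`-linear map `g^*Ω¹_{X₁/S} ⟶ Ω¹_{X₀/S}` with `η(da) ↦ d(g♯a)`.
[cite: Hartshorne1977, II Prop. 8.11 (the first map f^*Ω_{Y/Z} → Ω_{X/Z})] -/
theorem cotangentSheaf.eq_pullbackHom_of_app_unitSection_dSection
    (φ : (Scheme.Modules.pullback g.left).obj (cotangentSheaf X₁) ⟶ cotangentSheaf X₀)
    (h : ∀ (V : X₁.left.Opens) (a : Γ(X₁.left, V)),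
      φ.app (g.left ⁻¹ᵁ V) (unitSection g.left (cotangentSheaf X₁) V (dSection X₁ V a)) =
        dSection X₀ (g.left ⁻¹ᵁ V) (g.left.app V a)) :
    φ = cotangentSheaf.pullbackHom g :=
  cotangentSheaf.pullback_hom_ext _ _ fun V a => by
    rw [h, cotangentSheaf.pullbackHom_app_unitSection_dSection]

end PullbackHom

/-! ## §2 Functoriality: extensionality on pulled-back sections, chain rule, identity, isomorphisms -/

section PullbackExt

variable {X Y : Scheme.{u}} (f : X ⟶ Y) (M : Y.Modules) {N : X.Modules}

/-- The transpose `φ♭ : M ⟶ f_*N` of an `𝒪_X`-linear `φ : f^*M ⟶ N` on sections: `φ♭(m) = φ(η(m))`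
(`φ♭ = η ≫ f_*φ`, Mathlib `Adjunction.homEquiv_unit`). [cite: Hartshorne1977, II §5 p. 110 (f^* ⊣ f_*)] -/
theorem pullbackObj_homEquiv_app (φ : (Scheme.Modules.pullback f).obj M ⟶ N) (V : Y.Opens) (m : Γ(M, V)) :
    ((Scheme.Modules.pullbackPushforwardAdjunction f).homEquiv _ _ φ).app V m =
      φ.app (f ⁻¹ᵁ V) (unitSection f M V m) := by
  rw [Adjunction.homEquiv_unit]
  rfl

/-- **Two `𝒪_X`-linear maps out of `f^*M` that agree on all pulled-back sections `η(m)` are equal** (their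
transposes `M ⟶ f_*N` agree). [cite: Hartshorne1977, II §5 p. 110 (f^* ⊣ f_*)] -/
theorem pullbackObj_hom_ext_unitSection (φ₁ φ₂ : (Scheme.Modules.pullback f).obj M ⟶ N)
    (h : ∀ (V : Y.Opens) (m : Γ(M, V)),
      φ₁.app (f ⁻¹ᵁ V) (unitSection f M V m) = φ₂.app (f ⁻¹ᵁ V) (unitSection f M V m)) : φ₁ = φ₂ := by
  apply ((Scheme.Modules.pullbackPushforwardAdjunction f).homEquiv _ _).injective
  refine Scheme.Modules.hom_ext _ _ fun V => ?_
  ext m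
  rw [pullbackObj_homEquiv_app, pullbackObj_homEquiv_app]
  exact h V m

/-- **`(𝟙_X)^*` fixes pulled-back sections**: Mathlib's `Scheme.Modules.pullbackId : (𝟙 X)^* ≅ 𝟭` sends
`η_{𝟙}(m) ∈ Γ(V, (𝟙 X)^*M)` to `m` (transpose of `Scheme.Modules.conjugateEquiv_pullbackId_hom`).
[cite: Hartshorne1977, II §5 p. 110 (f^* ⊣ f_*)] -/
theorem pullbackId_hom_app_unitSection (M : X.Modules) (V : X.Opens) (m : Γ(M, V)) :
    ((Scheme.Modules.pullbackId X).hom.app M).app ((𝟙 X) ⁻¹ᵁ V) (unitSection (𝟙 X) M V m) = m := by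
  have h := unit_conjugateEquiv Adjunction.id (Scheme.Modules.pullbackPushforwardAdjunction (𝟙 X))
    (Scheme.Modules.pullbackId X).hom M
  rw [Scheme.Modules.conjugateEquiv_pullbackId_hom] at h
  have h' := congrArg (fun φ => (Scheme.Modules.Hom.app φ V) m) h
  simp only [Scheme.Modules.Hom.comp_app] at h'
  exact h'.symm

end PullbackExt

section ChainRule

variable {S : Type u} [CommRing S] {X₀ X₁ X₂ : Over (Spec (CommRingCat.of S))} (g : X₀ ⟶ X₁) (g' : X₁ ⟶ X₂)

variable {g g'} in
/-- **Two `𝒪_{X₀}`-linear maps out of `g^*g'^*Ω¹_{X₂/S}` that agree on the twice pulled-back exact forms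
`η_g(η_{g'}(da))` are equal** (transpose along `g`, then `cotangentSheaf.pullback_hom_ext` along `g'`).
[cite: Hartshorne1977, II.8 (p. 172–175: Ω_{B/A} is generated by the db) and II §5 p. 110 (f^* ⊣ f_*)] -/
theorem cotangentSheaf.pullback_pullback_hom_ext {N : X₀.left.Modules}
    (φ₁ φ₂ : (Scheme.Modules.pullback g.left).obj
      ((Scheme.Modules.pullback g'.left).obj (cotangentSheaf X₂)) ⟶ N)
    (h : ∀ (V : X₂.left.Opens) (a : Γ(X₂.left, V)),
      φ₁.app (g.left ⁻¹ᵁ (g'.left ⁻¹ᵁ V)) (unitSection g.left _ (g'.left ⁻¹ᵁ V)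
          (unitSection g'.left (cotangentSheaf X₂) V (dSection X₂ V a))) =
        φ₂.app (g.left ⁻¹ᵁ (g'.left ⁻¹ᵁ V)) (unitSection g.left _ (g'.left ⁻¹ᵁ V)
          (unitSection g'.left (cotangentSheaf X₂) V (dSection X₂ V a)))) : φ₁ = φ₂ := by
  apply ((Scheme.Modules.pullbackPushforwardAdjunction g.left).homEquiv _ _).injective
  refine cotangentSheaf.pullback_hom_ext _ _ fun V a => ?_
  rw [pullbackObj_homEquiv_app, pullbackObj_homEquiv_app]
  exact h V a

/-- **Chain rule** `d(g ≫ g') = g^*(dg') ≫ dg` for `1`-forms, up to Mathlib's pseudofunctoriality isomorphism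
`(g ≫ g')^* ≅ g^* g'^*` (`Scheme.Modules.pullbackComp`): both sides send `η_g(η_{g'}(da))` to `d(g♯ g'♯ a)`.
[cite: Hartshorne1977, II Prop. 8.11 (the first map f^*Ω_{Y/Z} → Ω_{X/Z}; functoriality)] -/
theorem cotangentSheaf.pullbackComp_hom_comp_pullbackHom :
    (Scheme.Modules.pullbackComp g.left g'.left).hom.app (cotangentSheaf X₂) ≫
        cotangentSheaf.pullbackHom (g ≫ g') =
      (Scheme.Modules.pullback g.left).map (cotangentSheaf.pullbackHom g') ≫ cotangentSheaf.pullbackHom g := by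
  refine cotangentSheaf.pullback_pullback_hom_ext _ _ fun V a => ?_
  rw [Scheme.Modules.Hom.comp_app, Scheme.Modules.Hom.comp_app]
  change (cotangentSheaf.pullbackHom (g ≫ g')).app _
      (((Scheme.Modules.pullbackComp g.left g'.left).hom.app (cotangentSheaf X₂)).app _ _) =
    (cotangentSheaf.pullbackHom g).app _
      (((Scheme.Modules.pullback g.left).map (cotangentSheaf.pullbackHom g')).app _ _)
  rw [pullbackComp_hom_app_unitSection g'.left (cotangentSheaf X₂) g.left V (dSection X₂ V a),
    pullback_map_app_unitSection, cotangentSheaf.pullbackHom_app_unitSection_dSection,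
    cotangentSheaf.pullbackHom_app_unitSection_dSection]
  exact cotangentSheaf.pullbackHom_app_unitSection_dSection (g ≫ g') V a

/-- The chain rule with the pseudofunctoriality isomorphism on the other side:
`d(g ≫ g') = ((g ≫ g')^* ≅ g^* g'^*) ≫ g^*(dg') ≫ dg`.
[cite: Hartshorne1977, II Prop. 8.11 (the first map f^*Ω_{Y/Z} → Ω_{X/Z}; functoriality)] -/
theorem cotangentSheaf.pullbackHom_comp :
    cotangentSheaf.pullbackHom (g ≫ g') =
      (Scheme.Modules.pullbackComp g.left g'.left).inv.app (cotangentSheaf X₂) ≫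
        (Scheme.Modules.pullback g.left).map (cotangentSheaf.pullbackHom g') ≫ cotangentSheaf.pullbackHom g := by
  rw [← cotangentSheaf.pullbackComp_hom_comp_pullbackHom, ← Category.assoc, Iso.inv_hom_id_app]
  exact (Category.id_comp _).symm

variable {g} in
/-- `dg` along equal morphisms `g = g₁`, through Mathlib's `Scheme.Modules.pullbackCongr`.
[cite: Hartshorne1977, II Prop. 8.11 (the first map f^*Ω_{Y/Z} → Ω_{X/Z}; functoriality)] -/
theorem cotangentSheaf.pullbackHom_congr {g₁ : X₀ ⟶ X₁} (h : g = g₁) :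
    cotangentSheaf.pullbackHom g =
      (Scheme.Modules.pullbackCongr (show g.left = g₁.left by rw [h])).hom.app (cotangentSheaf X₁) ≫
        cotangentSheaf.pullbackHom g₁ := by
  subst h
  simp [Scheme.Modules.pullbackCongr]

/-- **`d(𝟙_X)` is the identity**: along the identity of an `S`-scheme, `pullbackHom` is Mathlib's
`Scheme.Modules.pullbackId : (𝟙 X)^*Ω¹ ≅ Ω¹` (both send `η(da)` to `da`).
[cite: Hartshorne1977, II Prop. 8.11 (the first map f^*Ω_{Y/Z} → Ω_{X/Z}; functoriality)] -/
theorem cotangentSheaf.pullbackHom_id (X : Over (Spec (CommRingCat.of S))) :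
    cotangentSheaf.pullbackHom (𝟙 X) = (Scheme.Modules.pullbackId X.left).hom.app (cotangentSheaf X) := by
  refine cotangentSheaf.pullback_hom_ext _ _ fun V a => ?_
  rw [cotangentSheaf.pullbackHom_app_unitSection_dSection]
  exact (pullbackId_hom_app_unitSection (cotangentSheaf X) V (dSection X V a)).symm

/-- `dg = g^*(g^♯) ≫ ε`: `pullbackHom` is `g^*` of the adjoint form `cotangentSheaf.comap g` followed by the counit of
`g^* ⊣ g_*` (Mathlib `Adjunction.homEquiv_counit`). [cite: Hartshorne1977, II §5 p. 110 (f^* ⊣ f_*)] -/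
theorem cotangentSheaf.pullbackHom_eq_map_comap_comp_counit :
    cotangentSheaf.pullbackHom g =
      (Scheme.Modules.pullback g.left).map (cotangentSheaf.comap g) ≫
        (Scheme.Modules.pullbackPushforwardAdjunction g.left).counit.app (cotangentSheaf X₀) :=
  Adjunction.homEquiv_counit _ _ _ _

/-- **Along an isomorphism `e : X₀ ≅ X₁` of `S`-schemes, `de : e^*Ω¹_{X₁/S} ⟶ Ω¹_{X₀/S}` is an isomorphism**:
`de = e^*(e^♯) ≫ ε` with `e^♯` an isomorphism (`CotangentSheafComap.isIso_comap_hom`) and the counit `ε` of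
`e^* ⊣ e_*` an isomorphism, `e_*` being fully faithful for the open immersion `e` (Mathlib).
[cite: Hartshorne1977, II Prop. 8.11 (the first map f^*Ω_{Y/Z} → Ω_{X/Z}; an isomorphism for f an isomorphism)] -/
theorem cotangentSheaf.isIso_pullbackHom_of_iso (e : X₀ ≅ X₁) : IsIso (cotangentSheaf.pullbackHom e.hom) := by
  haveI : IsIso e.hom.left := (inferInstance : IsIso ((Over.forget _).map e.hom))
  rw [cotangentSheaf.pullbackHom_eq_map_comap_comp_counit]
  infer_instance

end ChainRule

end Literature.AlgebraicGeometry.HodgeTheory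

end
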